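import Summits.RiemannHypothesis.RiemannHypothesis.Theorems.GapsEvoDoorsInOptListCalc

/-!
# GapsEvoDoors — IN-OPT certificate, part 3: monomial expansions and inner closed forms

The monomial expansions of `fS(v)²`, `fS(v)fS(u+v)`, `fS(v)fS(u₁+u₂+v)+fS(u₁+v)fS(u₂+v)` against the
lists `LC`, `LA`, `LB` (by `ring`), the inner `v`-integrals of Inoue's `𝓜` at `s = 105/256` in
closed form (`Ccf`, `Acf`, `Bcf`), their signs (`fS ≥ 0` on `[0,1]`) and continuity. computed-record
rung: executes the higher-degree optimisation anticipated in Inoue 2026 (arXiv:2604.05733) Remark 1;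
no printed constant below 0.508949 under RH alone as of 2026-08; instrument rows eng-2
j289119/j289121, eng-1 R-aIN-E1-g0-01 j289591/j289692/j289724, referee VERDICTS.md 3e883a7033d14144
V-2/V-3/V-4; PREREG A1 cd26ffc3f46dafba; conditional on RH and on `inoue2026_theorem2` (preprint
CLAIM); μ-currency RECORD class, not the CI door; computed ≠ proved outside this kernel certificate;
nothing here bears on the truth of RH.
-/

noncomputable section

open MeasureTheory Set Finset Real Literature.NumberTheory.LFunctions

open scoped Real Interval

set_option linter.dupNamespace false  -- the mandated namespace repeats `RiemannHypothesis`

namespace Summit.RiemannHypothesis.RiemannHypothesis.Theorems.GapsEvoDoorsInOpt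

/-! ### 5. The quartic `fS`, its coefficient lists, inner closed forms -/

/-- `fS ≥ 0` on `(-∞, 1]` (indeed `fS ≥ 0.249` on `[0,1]`). -/
theorem fS_nonneg {x : ℝ} (h1 : x ≤ 1) : 0 ≤ fS x := by
  unfold fS
  have hq1 : 0 ≤ 1 - 130183 / 100000 * x + 55 / 100 * x ^ 2 := by nlinarith [sq_nonneg (x - 118348 / 100000)]
  have hq2 : 0 ≤ 56447 / 100000 - 70250 / 100000 * x + 13937 / 100000 * x ^ 2 := by nlinarith
  have hx2 : 0 ≤ x ^ 2 := sq_nonneg x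
  nlinarith [mul_nonneg hx2 hq2]

/-- `fS` is continuous. -/
theorem fS_continuous : Continuous fS := by unfold fS; fun_prop

/-- Monomial expansion of `fS(v)²` (checked by `ring`). -/
theorem fS_sq_expand (v : ℝ) : fS v ^ 2 = (LC.map (fun t : ℝ × ℕ => t.1 * v ^ t.2)).sum := by
  simp only [LC, List.map, List.sum_cons, List.sum_nil, fS]
  ring

/-- Monomial expansion of `fS(v)fS(u+v)` (checked by `ring`). -/
theorem fS_mul_shift_expand (u v : ℝ) :
    fS v * fS (u + v) = (LA.map (fun t : ℝ × ℕ × ℕ => t.1 * u ^ t.2.2 * v ^ t.2.1)).sum := by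
  simp only [LA, List.map, List.sum_cons, List.sum_nil, fS]
  ring

set_option maxHeartbeats 4000000 in
/-- Monomial expansion of `fS(v)fS(u₁+u₂+v) + fS(u₁+v)fS(u₂+v)` (checked by `ring`). -/
theorem fS_B_expand (u₁ u₂ v : ℝ) :
    fS v * fS (u₁ + u₂ + v) + fS (u₁ + v) * fS (u₂ + v)
      = (LB.map (fun t : ℝ × ℕ × ℕ × ℕ => t.1 * u₁ ^ t.2.2.1 * u₂ ^ t.2.2.2 * v ^ t.2.1)).sum := by
  simp only [LB, List.map, List.sum_cons, List.sum_nil, fS]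
  ring

/-- Closed form of the inner `v`-integral of `T_C` (`u ≤ 1`). -/
theorem innerC_eq {u : ℝ} (hu : u ≤ 1) :
    ∫ v in (0 : ℝ)..(1 - u), fS v ^ 2 * v ^ (105 / 256 : ℝ) = Ccf u := by
  have e : (fun v : ℝ => fS v ^ 2 * v ^ (105 / 256 : ℝ))
      = fun v => (LC.map (fun t : ℝ × ℕ => t.1 * v ^ t.2)).sum * v ^ (105 / 256 : ℝ) := by
    ext v; rw [fS_sq_expand]
  rw [e, integral_listSum_pow_rpow LC (fun t => t.1) (fun t => t.2) (by norm_num) (by linarith)]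
  rfl

/-- Closed form of the inner `v`-integral of `T_A` (`u ≤ 1`). -/
theorem innerA_eq {u : ℝ} (hu : u ≤ 1) :
    ∫ v in (0 : ℝ)..(1 - u), fS v * fS (u + v) * v ^ (105 / 256 : ℝ) = Acf u := by
  have e : (fun v : ℝ => fS v * fS (u + v) * v ^ (105 / 256 : ℝ))
      = fun v => (LA.map (fun t : ℝ × ℕ × ℕ => t.1 * u ^ t.2.2 * v ^ t.2.1)).sum * v ^ (105 / 256 : ℝ) := by
    ext v; rw [fS_mul_shift_expand]
  rw [e, integral_listSum_pow_rpow LA (fun t => t.1 * u ^ t.2.2) (fun t => t.2.1) (by norm_num) (by linarith)]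
  rfl

/-- Closed form of the inner `v`-integral of `T_B` (`u₁ + u₂ ≤ 1`). -/
theorem innerB_eq {u₁ u₂ : ℝ} (h : u₁ + u₂ ≤ 1) :
    ∫ v in (0 : ℝ)..(1 - (u₁ + u₂)), (fS v * fS (u₁ + u₂ + v) + fS (u₁ + v) * fS (u₂ + v)) * v ^ (105 / 256 : ℝ)
      = Bcf u₁ u₂ := by
  have e : (fun v : ℝ => (fS v * fS (u₁ + u₂ + v) + fS (u₁ + v) * fS (u₂ + v)) * v ^ (105 / 256 : ℝ))
      = fun v => (LB.map (fun t : ℝ × ℕ × ℕ × ℕ => t.1 * u₁ ^ t.2.2.1 * u₂ ^ t.2.2.2 * v ^ t.2.1)).sum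
          * v ^ (105 / 256 : ℝ) := by
    ext v; rw [fS_B_expand]
  rw [e, integral_listSum_pow_rpow LB (fun t => t.1 * u₁ ^ t.2.2.1 * u₂ ^ t.2.2.2) (fun t => t.2.1)
    (by norm_num) (by linarith)]
  unfold Bcf
  rw [show (1 : ℝ) - (u₁ + u₂) = 1 - u₁ - u₂ by ring]

/-- The inner integral of `T_C` is `≥ 0`. -/
theorem innerC_nonneg {u : ℝ} (hu : u ≤ 1) :
    0 ≤ ∫ v in (0 : ℝ)..(1 - u), fS v ^ 2 * v ^ (105 / 256 : ℝ) :=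
  intervalIntegral.integral_nonneg (by linarith) fun v hv => mul_nonneg (sq_nonneg _) (Real.rpow_nonneg hv.1 _)

/-- The inner integral of `T_A` is `≥ 0` (`fS ≥ 0` on `[0,1]`). -/
theorem innerA_nonneg {u : ℝ} (hu0 : 0 ≤ u) (hu : u ≤ 1) :
    0 ≤ ∫ v in (0 : ℝ)..(1 - u), fS v * fS (u + v) * v ^ (105 / 256 : ℝ) :=
  intervalIntegral.integral_nonneg (by linarith) fun v hv =>
    mul_nonneg (mul_nonneg (fS_nonneg (by linarith [hv.2])) (fS_nonneg (by linarith [hv.2])))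
      (Real.rpow_nonneg hv.1 _)

/-- The inner integral of `T_B` is `≥ 0` (`fS ≥ 0` on `[0,1]`). -/
theorem innerB_nonneg {u₁ u₂ : ℝ} (h₁ : 0 ≤ u₁) (h₂ : 0 ≤ u₂) (h : u₁ + u₂ ≤ 1) :
    0 ≤ ∫ v in (0 : ℝ)..(1 - (u₁ + u₂)), (fS v * fS (u₁ + u₂ + v) + fS (u₁ + v) * fS (u₂ + v)) * v ^ (105 / 256 : ℝ) :=
  intervalIntegral.integral_nonneg (by linarith) fun v hv =>
    mul_nonneg
      (add_nonneg
        (mul_nonneg (fS_nonneg (by linarith [hv.2])) (fS_nonneg (by linarith [hv.2])))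
        (mul_nonneg (fS_nonneg (by linarith [hv.2])) (fS_nonneg (by linarith [hv.2]))))
      (Real.rpow_nonneg hv.1 _)

/-- `Ccf ≥ 0` on `(-∞,1]`. -/
theorem Ccf_nonneg {u : ℝ} (hu : u ≤ 1) : 0 ≤ Ccf u := by rw [← innerC_eq hu]; exact innerC_nonneg hu

/-- `Acf ≥ 0` on `[0,1]`. -/
theorem Acf_nonneg {u : ℝ} (hu0 : 0 ≤ u) (hu : u ≤ 1) : 0 ≤ Acf u := by
  rw [← innerA_eq hu]; exact innerA_nonneg hu0 hu

/-- `Bcf ≥ 0` on the simplex. -/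
theorem Bcf_nonneg {u₁ u₂ : ℝ} (h₁ : 0 ≤ u₁) (h₂ : 0 ≤ u₂) (h : u₁ + u₂ ≤ 1) : 0 ≤ Bcf u₁ u₂ := by
  rw [← innerB_eq h]; exact innerB_nonneg h₁ h₂ h

/-- `Ccf` is continuous. -/
theorem Ccf_continuous : Continuous Ccf := by
  unfold Ccf
  refine continuous_listSum LC _ fun t => ?_
  exact continuous_const.mul ((continuous_sub_rpow 1 (by positivity)).div_const _)

/-- `Acf` is continuous. -/
theorem Acf_continuous : Continuous Acf := by
  unfold Acf
  refine continuous_listSum LA _ fun t => ?_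
  exact (continuous_const.mul (continuous_pow _)).mul ((continuous_sub_rpow 1 (by positivity)).div_const _)

/-- `Bcf` is jointly continuous on `ℝ × ℝ`. -/
theorem Bcf_continuous₂ : Continuous fun q : ℝ × ℝ => Bcf q.1 q.2 := by
  unfold Bcf
  refine continuous_listSum LB (fun t (q : ℝ × ℝ) => t.1 * q.1 ^ t.2.2.1 * q.2 ^ t.2.2.2 *
    ((1 - q.1 - q.2) ^ ((105 / 256 : ℝ) + 1 + t.2.1) / (105 / 256 + 1 + t.2.1))) fun t => ?_
  have hr : Continuous fun q : ℝ × ℝ => (1 - q.1 - q.2) ^ ((105 / 256 : ℝ) + 1 + t.2.1) :=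
    ((continuous_const.sub continuous_fst).sub continuous_snd).rpow_const fun _ => Or.inr (by positivity)
  exact ((continuous_const.mul (continuous_fst.pow _)).mul (continuous_snd.pow _)).mul (hr.div_const _)

/-- `Bcf u₁ ·` is continuous. -/
theorem Bcf_continuous (u₁ : ℝ) : Continuous fun u₂ : ℝ => Bcf u₁ u₂ :=
  Bcf_continuous₂.comp (continuous_const.prodMk continuous_id)

end Summit.RiemannHypothesis.RiemannHypothesis.Theorems.GapsEvoDoorsInOpt

end
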